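import Summits.QuantumFields.YangMills.Theses.FradkinShenkerFlow
import Summits.QuantumFields.YangMills.Theorems.FradkinShenkerFlowSusceptibilityToPoincareOrbitSliceSplit
import Summits.QuantumFields.YangMills.Theorems.FradkinShenkerFlowSusceptibilityToPoincareOrbitEfronStein
import Literature.MathematicalPhysics.QuantumLattice.TorusWilsonLinkTranslations

/-!
# Stub `stub_siteRotation_le` of the line `orbit-slice-reduction` (crux `SusceptibilityToPoincare`)

Route `FradkinShenkerFlow` of `YangMills`, crux item `stmt-QuantumFields-9441`
(`Summit.QuantumFields.YangMills.Theses.FradkinShenkerFlow.SusceptibilityToPoincare`, FS ⇒ UP),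
stub (2b) of the skeleton `Cruxes/SusceptibilityToPoincare/Lines/orbit-slice-reduction.lean`:
**a site rotation of the torus Wilson measure costs at most the Haar resampling of its incident
links** — for the 4D torus of side `2S+1`, `μ = wilsonMeasure r.ρ β`, bounded measurable `F`
and a site `x`, `∫∫ (F U − F(U^{k at x}))² dHaar(k) dμ(U) ≤ C Σ_{ℓ ∋ x} H_ℓ` with
`H_ℓ = ∫∫ (F U − F(U[ℓ ↦ h]))² dHaar(h) dμ(U)`, `U^{k at x} = gaugeTransform (update 1 x k) U`,
`ℓ ∋ x` meaning `ℓ.1 = x ∨ ℓ.1.shift ℓ.2 = x`, and `C = C(G, r, β)` independent of `S, F, x`.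

Proof. For fixed `k` the rotation is the edgewise two-sided translation
`U ↦ (e ↦ a e · U e · (c e)⁻¹)` with `a e = k` if `e.1 = x`, `c e = k` if `e.1 + e_{e.2} = x`,
`1` otherwise, supported on the `≤ 8` incident links. For ANY probability measure on `G^E`
under which translating the links of `A` costs at most a factor `e^{κ|A|}` on nonnegative
integrands: moving one link `e₀` by a two-sided translation costs `≤ (2 + 2e^κ) H_{e₀}`
(`SiteRotation.integral_sq_sub_update_le` — insert an independent Haar link value `h`,
`(F W − F W')² ≤ 2(F W − F(W[e₀↦h]))² + 2(F W' − F(W'[e₀↦h]))²` as `W'[e₀↦h] = W[e₀↦h]`,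
average over `h`, bound the law of `W'` by `e^κ μ`), and translating the links of `A` costs
`≤ 2^{|A|} e^{κ|A|} (2 + 2e^κ) Σ_{e ∈ A} H_e` (`SiteRotation.integral_sq_sub_translate_le`,
telescoping by induction on `A`). The Wilson measure has this density bound with
`κ = |β| · 2 (4+1) #{planes} (N + M_ρ)` uniformly in the volume
(`Literature.MathematicalPhysics.QuantumLattice.integral_comp_edgeTranslate_wilsonMeasure_le`).
Finally swap the `k`- and `U`-integrals (bounded jointly measurable integrand; `G` is second
countable through the faithful `r`) and average the `k`-uniform bound over `k`.
-/

noncomputable section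

open MeasureTheory ProbabilityTheory
open Literature.MathematicalPhysics.QuantumFieldTheory
open Literature.MathematicalPhysics.QuantumLattice (integral_comp_edgeTranslate_wilsonMeasure_le
  card_filter_incident_le)

namespace Summit.QuantumFields.YangMills.Theorems.SusceptibilityToPoincare.SiteRotation

/-! ### Abstract measure theory: squared differences of a bounded function -/

section Abstract

variable {Ω K : Type*} [MeasurableSpace Ω] [MeasurableSpace K]

/-- Squared differences of two measurable functions bounded by `B` are integrable against a
finite measure. [folklore] -/
theorem integrable_sq_sub {μ : Measure Ω} [IsFiniteMeasure μ] {f g : Ω → ℝ}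
    (hf : Measurable f) (hg : Measurable g) {B : ℝ} (hfB : ∀ ω, |f ω| ≤ B)
    (hgB : ∀ ω, |g ω| ≤ B) : Integrable (fun ω => (f ω - g ω) ^ 2) μ :=
  Integrable.of_bound ((hf.sub hg).pow_const 2).aestronglyMeasurable ((2 * B) ^ 2)
    (ae_of_all _ fun ω => OrbitES.norm_sq_sub_le (hfB ω) (hgB ω))

/-- Measurability of the parametric integral `ω ↦ ∫ (F ω - F (act (ω, k)))² dν(k)` for
measurable `F` and a jointly measurable `act`. [folklore] -/
theorem measurable_integral_sq_sub {ν : Measure K} [SFinite ν] {F : Ω → ℝ}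
    (hF : Measurable F) {act : Ω × K → Ω} (hact : Measurable act) :
    Measurable fun ω => ∫ k, (F ω - F (act (ω, k))) ^ 2 ∂ν := by
  have h : Measurable fun p : Ω × K => (F p.1 - F (act p)) ^ 2 :=
    ((hF.comp measurable_fst).sub (hF.comp hact)).pow_const 2
  exact (h.stronglyMeasurable.integral_prod_right' (ν := ν)).measurable

omit [MeasurableSpace Ω] in
/-- The parametric integral `∫ (F ω - F (act (ω, k)))² dν(k)` over a probability measure is
bounded by `(2B)²` when `|F| ≤ B`. [folklore] -/
theorem abs_integral_sq_sub_le {ν : Measure K} [IsProbabilityMeasure ν] {F : Ω → ℝ} {B : ℝ}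
    (hB : ∀ ω, |F ω| ≤ B) (act : Ω × K → Ω) (ω : Ω) :
    |∫ k, (F ω - F (act (ω, k))) ^ 2 ∂ν| ≤ (2 * B) ^ 2 := by
  have := norm_integral_le_of_norm_le_const (μ := ν) (f := fun k => (F ω - F (act (ω, k))) ^ 2)
    (C := (2 * B) ^ 2) (ae_of_all _ fun k => OrbitES.norm_sq_sub_le (hB ω) (hB _))
  simpa [Real.norm_eq_abs, probReal_univ] using this

/-- The arithmetic of the telescoping step: from `P ≤ 2ⁿ E₀ D X`, `Q ≤ E₀ (D Y)`, `E₀ ≤ E₁`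
and nonnegativity, `2P + 2Q ≤ 2ⁿ⁺¹ E₁ D (Y + X)`. [folklore] -/
theorem step_arith {P Q X Y E₀ E₁ D : ℝ} (n : ℕ) (hP : P ≤ 2 ^ n * E₀ * D * X)
    (hQ : Q ≤ E₀ * (D * Y)) (hE : E₀ ≤ E₁) (hE0 : 0 ≤ E₀) (hD : 0 ≤ D) (hX : 0 ≤ X)
    (hY : 0 ≤ Y) :
    2 * P + 2 * Q ≤ 2 ^ (n + 1) * E₁ * D * (Y + X) := by
  have h2n : (1 : ℝ) ≤ 2 ^ n := one_le_pow₀ (by norm_num)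
  have hDY : 0 ≤ D * Y := mul_nonneg hD hY
  have hDX : 0 ≤ D * X := mul_nonneg hD hX
  have h1 : 2 ^ n * E₀ * D * X ≤ 2 ^ n * E₁ * (D * X) := by
    rw [mul_assoc (2 ^ n * E₀)]
    gcongr
  have h2 : E₀ * (D * Y) ≤ 2 ^ n * E₁ * (D * Y) := by
    calc E₀ * (D * Y) = 1 * E₀ * (D * Y) := by ring
      _ ≤ 2 ^ n * E₁ * (D * Y) := by gcongr
  calc 2 * P + 2 * Q ≤ 2 * (2 ^ n * E₁ * (D * X)) + 2 * (2 ^ n * E₁ * (D * Y)) := by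
        linarith [hP.trans h1, hQ.trans h2]
    _ = 2 ^ (n + 1) * E₁ * D * (Y + X) := by ring

end Abstract

/-! ### Moving links under a translation-density bound (any probability measure on `G^E`) -/

section Moving

variable {d L : ℕ} {G : Type*} [Group G] [TopologicalSpace G] [IsTopologicalGroup G]
  [CompactSpace G] [MeasurableSpace G] [BorelSpace G] {μ : Measure (GaugeConfig d L G)}
  [IsProbabilityMeasure μ] {κ : ℝ}

/-- **One-link step.** For a probability measure `μ` on `G^E` under which translating the
links of any `A` costs at most `e^{κ|A|}` on nonnegative integrands (`hdens`) and measurable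
`F` with `|F| ≤ B`, moving the link `e₀` by `W ↦ W' = W[e₀ ↦ a₀ W(e₀) c₀⁻¹]` costs at most
`(2 + 2e^κ) ∫∫ (F U - F(U[e₀ ↦ h]))² dHaar(h) dμ(U)`: for an independent Haar link value `h`,
`(F W - F W')² ≤ 2(F W - F(W[e₀↦h]))² + 2(F W' - F(W'[e₀↦h]))²` since `W'[e₀↦h] = W[e₀↦h]`;
average over `h` and bound the law of `W'` by `e^κ μ`. [folklore] -/
theorem integral_sq_sub_update_le
    (hdens : ∀ (A : Finset (Edge d L)) (a c : Edge d L → G), (∀ e ∉ A, a e = 1) →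
      (∀ e ∉ A, c e = 1) → ∀ ψ : GaugeConfig d L G → ℝ, (∀ V, 0 ≤ ψ V) →
      Integrable ψ μ →
      ∫ V, ψ (fun e => a e * V e * (c e)⁻¹) ∂μ ≤ Real.exp (κ * A.card) * ∫ V, ψ V ∂μ)
    {F : GaugeConfig d L G → ℝ} (hF : Measurable F) {B : ℝ} (hB : ∀ U, |F U| ≤ B)
    (e₀ : Edge d L) (a₀ c₀ : G) :
    ∫ W, (F W - F (Function.update W e₀ (a₀ * W e₀ * c₀⁻¹))) ^ 2 ∂μ ≤
      (2 + 2 * Real.exp κ) *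
        ∫ U, ∫ h, (F U - F (Function.update U e₀ h)) ^ 2 ∂(haarProbability G) ∂μ := by
  set Φ : GaugeConfig d L G → ℝ := fun V =>
    ∫ h, (F V - F (Function.update V e₀ h)) ^ 2 ∂(haarProbability G) with hΦ
  set τ : GaugeConfig d L G → GaugeConfig d L G := fun W =>
    Function.update W e₀ (a₀ * W e₀ * c₀⁻¹) with hτ
  have hτm : Measurable τ := by
    rw [hτ]
    exact measurable_update'.comp
      (measurable_id.prodMk (((measurable_pi_apply e₀).const_mul _).mul_const _))
  have hΦm : Measurable Φ := measurable_integral_sq_sub hF measurable_update'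
  have hΦ0 : ∀ V, 0 ≤ Φ V := fun V => integral_nonneg fun h => sq_nonneg _
  have hΦb : ∀ V, ‖Φ V‖ ≤ (2 * B) ^ 2 := fun V => by
    rw [Real.norm_eq_abs]
    exact abs_integral_sq_sub_le hB (fun p : GaugeConfig d L G × G => Function.update p.1 e₀ p.2) V
  have hΦi : Integrable Φ μ := Integrable.of_bound hΦm.aestronglyMeasurable _ (ae_of_all _ hΦb)
  have hΦτi : Integrable (fun W => Φ (τ W)) μ :=
    Integrable.of_bound (hΦm.comp hτm).aestronglyMeasurable _ (ae_of_all _ fun W => hΦb (τ W))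
  -- pointwise in `W`: insert an independent Haar link value at `e₀`
  have hpt : ∀ W, (F W - F (τ W)) ^ 2 ≤ 2 * Φ W + 2 * Φ (τ W) := by
    intro W
    have hupd : ∀ h, Function.update (τ W) e₀ h = Function.update W e₀ h := fun h =>
      Function.update_idem _ _ _
    have hi1 : Integrable (fun h => (F W - F (Function.update W e₀ h)) ^ 2) (haarProbability G) :=
      integrable_sq_sub measurable_const (hF.comp (measurable_update W)) (fun _ => hB _) fun _ => hB _
    have hi2 : Integrable (fun h => (F (τ W) - F (Function.update (τ W) e₀ h)) ^ 2)
        (haarProbability G) :=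
      integrable_sq_sub measurable_const (hF.comp (measurable_update _)) (fun _ => hB _) fun _ => hB _
    have key : ∀ h, (F W - F (τ W)) ^ 2 ≤ 2 * (F W - F (Function.update W e₀ h)) ^ 2 +
        2 * (F (τ W) - F (Function.update (τ W) e₀ h)) ^ 2 := fun h => by
      rw [hupd h]
      nlinarith [sq_nonneg (F W + F (τ W) - 2 * F (Function.update W e₀ h))]
    have hi12 : Integrable (fun h => 2 * (F W - F (Function.update W e₀ h)) ^ 2 +
        2 * (F (τ W) - F (Function.update (τ W) e₀ h)) ^ 2) (haarProbability G) :=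
      (hi1.const_mul 2).add (hi2.const_mul 2)
    have hmono := integral_mono (integrable_const ((F W - F (τ W)) ^ 2)) hi12 key
    rw [integral_const, probReal_univ, one_smul, integral_add (hi1.const_mul 2) (hi2.const_mul 2),
      integral_const_mul, integral_const_mul] at hmono
    exact hmono
  -- integrate against `μ`
  have hlhs : Integrable (fun W => (F W - F (τ W)) ^ 2) μ :=
    integrable_sq_sub hF (hF.comp hτm) hB fun W => hB _
  have h1 : ∫ W, (F W - F (τ W)) ^ 2 ∂μ ≤
      2 * ∫ W, Φ W ∂μ + 2 * ∫ W, Φ (τ W) ∂μ := by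
    calc ∫ W, (F W - F (τ W)) ^ 2 ∂μ ≤ ∫ W, (2 * Φ W + 2 * Φ (τ W)) ∂μ :=
          integral_mono hlhs ((hΦi.const_mul 2).add (hΦτi.const_mul 2)) hpt
      _ = 2 * ∫ W, Φ W ∂μ + 2 * ∫ W, Φ (τ W) ∂μ := by
          rw [integral_add (hΦi.const_mul 2) (hΦτi.const_mul 2), integral_const_mul,
            integral_const_mul]
  -- the law of `τ W` has density `≤ e^κ`: `τ` is the translation by `1[e₀ ↦ a₀]`, `1[e₀ ↦ c₀]`
  have hτeq : ∀ W, τ W = fun e => (Function.update (1 : Edge d L → G) e₀ a₀) e * W e *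
      ((Function.update (1 : Edge d L → G) e₀ c₀) e)⁻¹ := by
    intro W; funext e; by_cases he : e = e₀
    · subst he
      simp [hτ]
    · simp [hτ, Function.update_of_ne he]
  have h2 : ∫ W, Φ (τ W) ∂μ ≤ Real.exp κ * ∫ W, Φ W ∂μ := by
    have h := hdens {e₀} (Function.update (1 : Edge d L → G) e₀ a₀)
      (Function.update (1 : Edge d L → G) e₀ c₀)
      (fun e he => by rw [Finset.mem_singleton] at he; simp [Function.update_of_ne he])
      (fun e he => by rw [Finset.mem_singleton] at he; simp [Function.update_of_ne he]) Φ hΦ0 hΦi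
    rw [Finset.card_singleton, Nat.cast_one, mul_one] at h
    simpa only [hτeq] using h
  have hH0 : 0 ≤ ∫ W, Φ W ∂μ := integral_nonneg hΦ0
  calc ∫ W, (F W - F (τ W)) ^ 2 ∂μ ≤ 2 * ∫ W, Φ W ∂μ + 2 * ∫ W, Φ (τ W) ∂μ := h1
    _ ≤ 2 * ∫ W, Φ W ∂μ + 2 * (Real.exp κ * ∫ W, Φ W ∂μ) := by gcongr
    _ = (2 + 2 * Real.exp κ) * ∫ W, Φ W ∂μ := by ring

/-- **Telescoping over the links of `A`.** Under the same translation-density hypothesis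
(`κ ≥ 0`), for every finite set `A` of links and `a, c` equal to `1` off `A`,
`∫ (F V - F(e ↦ a e V e (c e)⁻¹))² dμ(V) ≤ 2^{|A|} e^{κ|A|} (2 + 2e^κ) Σ_{e ∈ A} H_e`, by induction
on `A`: peel off one link `e₀` with `(x - z)² ≤ 2(x - y)² + 2(y - z)²`, `y = F` of the
configuration translated on `A ∖ {e₀}` only (law `≤ e^{κ|A|} μ`), then the one-link step. [folklore] -/
theorem integral_sq_sub_translate_le (hκ : 0 ≤ κ)
    (hdens : ∀ (A : Finset (Edge d L)) (a c : Edge d L → G), (∀ e ∉ A, a e = 1) →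
      (∀ e ∉ A, c e = 1) → ∀ ψ : GaugeConfig d L G → ℝ, (∀ V, 0 ≤ ψ V) →
      Integrable ψ μ →
      ∫ V, ψ (fun e => a e * V e * (c e)⁻¹) ∂μ ≤ Real.exp (κ * A.card) * ∫ V, ψ V ∂μ)
    {F : GaugeConfig d L G → ℝ} (hF : Measurable F) {B : ℝ} (hB : ∀ U, |F U| ≤ B)
    (A : Finset (Edge d L)) :
    ∀ a c : Edge d L → G, (∀ e ∉ A, a e = 1) → (∀ e ∉ A, c e = 1) →
      ∫ V, (F V - F (fun e => a e * V e * (c e)⁻¹)) ^ 2 ∂μ ≤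
        (2 ^ A.card * Real.exp (κ * A.card) * (2 + 2 * Real.exp κ)) *
          ∑ e ∈ A, ∫ U, ∫ h, (F U - F (Function.update U e h)) ^ 2 ∂(haarProbability G)
            ∂μ := by
  classical
  induction A using Finset.induction_on with
  | empty =>
    intro a c ha hc
    have h : ∀ V : GaugeConfig d L G, (fun e => a e * V e * (c e)⁻¹) = V := fun V =>
      funext fun e => by simp [ha e (Finset.notMem_empty e), hc e (Finset.notMem_empty e)]
    simp [h]
  | insert e₀ A he₀ IH =>
    intro a c ha hc
    set H : Edge d L → ℝ := fun e =>
      ∫ U, ∫ h, (F U - F (Function.update U e h)) ^ 2 ∂(haarProbability G) ∂μ with hH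
    have hH0 : ∀ e, 0 ≤ H e := fun e =>
      integral_nonneg fun _ => integral_nonneg fun _ => sq_nonneg _
    -- the translation on `A` only: `a' = a[e₀ ↦ 1]`, `c' = c[e₀ ↦ 1]`
    have h1off : ∀ f : Edge d L → G, (∀ e ∉ insert e₀ A, f e = 1) →
        ∀ e ∉ A, Function.update f e₀ 1 e = 1 := by
      intro f hf e he
      by_cases h : e = e₀
      · subst h
        simp
      · rw [Function.update_of_ne h]
        exact hf e (by simp [h, he])
    set a' : Edge d L → G := Function.update a e₀ 1 with ha'_def
    set c' : Edge d L → G := Function.update c e₀ 1 with hc'_def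
    have ha' : ∀ e ∉ A, a' e = 1 := h1off a ha
    have hc' : ∀ e ∉ A, c' e = 1 := h1off c hc
    set T' : GaugeConfig d L G → GaugeConfig d L G := fun V e => a' e * V e * (c' e)⁻¹ with hT'
    have hT'm : Measurable T' :=
      measurable_pi_lambda _ fun e => ((measurable_pi_apply e).const_mul _).mul_const _
    have hIH : ∫ V, (F V - F (T' V)) ^ 2 ∂μ ≤
        (2 ^ A.card * Real.exp (κ * A.card) * (2 + 2 * Real.exp κ)) * ∑ e ∈ A, H e :=
      IH a' c' ha' hc'
    -- the full translation is `T'` followed by the one-link move at `e₀`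
    have hcomp : ∀ V : GaugeConfig d L G, (fun e => a e * V e * (c e)⁻¹) =
        Function.update (T' V) e₀ (a e₀ * (T' V) e₀ * (c e₀)⁻¹) := by
      intro V; funext e; by_cases h : e = e₀
      · subst h
        simp [hT', ha'_def, hc'_def]
      · simp [hT', ha'_def, hc'_def, Function.update_of_ne h]
    set ψ : GaugeConfig d L G → ℝ := fun W =>
      (F W - F (Function.update W e₀ (a e₀ * W e₀ * (c e₀)⁻¹))) ^ 2 with hψ
    have hτm : Measurable fun W : GaugeConfig d L G =>
        Function.update W e₀ (a e₀ * W e₀ * (c e₀)⁻¹) := measurable_update'.comp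
      (measurable_id.prodMk (((measurable_pi_apply e₀).const_mul _).mul_const _))
    have hψm : Measurable ψ := (hF.sub (hF.comp hτm)).pow_const 2
    have hψ0 : ∀ W, 0 ≤ ψ W := fun W => sq_nonneg _
    have hψi : Integrable ψ μ := integrable_sq_sub hF (hF.comp hτm) hB fun W => hB _
    have hψT'i : Integrable (fun V => ψ (T' V)) μ := Integrable.of_bound
      (hψm.comp hT'm).aestronglyMeasurable ((2 * B) ^ 2) (ae_of_all _ fun V =>
        OrbitES.norm_sq_sub_le (hB _) (hB _))
    have hlhs : Integrable (fun V => (F V - F (fun e => a e * V e * (c e)⁻¹)) ^ 2) μ :=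
      integrable_sq_sub hF (hF.comp (measurable_pi_lambda _ fun e =>
        ((measurable_pi_apply e).const_mul _).mul_const _)) hB fun V => hB _
    have hi1 : Integrable (fun V => (F V - F (T' V)) ^ 2) μ :=
      integrable_sq_sub hF (hF.comp hT'm) hB fun V => hB _
    have hpt : ∀ V, (F V - F (fun e => a e * V e * (c e)⁻¹)) ^ 2 ≤
        2 * (F V - F (T' V)) ^ 2 + 2 * ψ (T' V) := fun V => by
      rw [hcomp V]
      simp only [hψ]
      nlinarith [sq_nonneg (F V - 2 * F (T' V) +
        F (Function.update (T' V) e₀ (a e₀ * (T' V) e₀ * (c e₀)⁻¹)))]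
    have h1 : ∫ V, (F V - F (fun e => a e * V e * (c e)⁻¹)) ^ 2 ∂μ ≤
        2 * ∫ V, (F V - F (T' V)) ^ 2 ∂μ + 2 * ∫ V, ψ (T' V) ∂μ := by
      calc ∫ V, (F V - F (fun e => a e * V e * (c e)⁻¹)) ^ 2 ∂μ
          ≤ ∫ V, (2 * (F V - F (T' V)) ^ 2 + 2 * ψ (T' V)) ∂μ :=
            integral_mono hlhs ((hi1.const_mul 2).add (hψT'i.const_mul 2)) hpt
        _ = 2 * ∫ V, (F V - F (T' V)) ^ 2 ∂μ + 2 * ∫ V, ψ (T' V) ∂μ := by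
            rw [integral_add (hi1.const_mul 2) (hψT'i.const_mul 2), integral_const_mul,
              integral_const_mul]
    -- density bound for the law of `T' V`, then the one-link step
    have h2 : ∫ V, ψ (T' V) ∂μ ≤ Real.exp (κ * A.card) * ∫ W, ψ W ∂μ :=
      hdens A a' c' ha' hc' ψ hψ0 hψi
    have h3 : ∫ W, ψ W ∂μ ≤ (2 + 2 * Real.exp κ) * H e₀ :=
      integral_sq_sub_update_le hdens hF hB e₀ (a e₀) (c e₀)
    have h23 : ∫ V, ψ (T' V) ∂μ ≤ Real.exp (κ * A.card) * ((2 + 2 * Real.exp κ) * H e₀) :=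
      h2.trans (mul_le_mul_of_nonneg_left h3 (Real.exp_pos _).le)
    have hE : Real.exp (κ * A.card) ≤ Real.exp (κ * ((A.card + 1 : ℕ) : ℝ)) := by
      refine Real.exp_le_exp.2 (mul_le_mul_of_nonneg_left ?_ hκ)
      exact_mod_cast Nat.le_succ _
    rw [Finset.sum_insert he₀, Finset.card_insert_of_notMem he₀]
    exact h1.trans (step_arith A.card hIH h23 hE (Real.exp_pos _).le (by positivity)
      (Finset.sum_nonneg fun e _ => hH0 e) (hH0 e₀))

end Moving

end Summit.QuantumFields.YangMills.Theorems.SusceptibilityToPoincare.SiteRotation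

namespace Summit.QuantumFields.YangMills.Theorems.SusceptibilityToPoincare

/-- `stub_siteRotation_le` — **a site rotation costs at most the Haar resampling of its incident
links** (stub (2b) of the line `orbit-slice-reduction`): for every compact group `G` with a
lattice representation `r` and real `β` there is `C = C(G, r, β)` (here
`2⁸ e^{8κ} (2 + 2e^κ)`, `κ = |β| · 2 (4+1) #{planes} (N + M_ρ)`) such that for every side
`2S+1`, bounded measurable `F` and site `x` of the 4D torus,
`∫∫ (F U − F(U^{k at x}))² dHaar(k) dμ(U) ≤ C Σ_{ℓ ∋ x} ∫∫ (F U − F(U[ℓ ↦ h]))² dHaar(h) dμ(U)`,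
`μ = wilsonMeasure r.ρ β` (telescoping over the `≤ 8` incident links with the volume-uniform
translation-density bound of the Wilson measure, then Fubini in `(U, k)`). [folklore] -/
theorem stub_siteRotation_le :
    ∀ (G : Type) [Group G] [TopologicalSpace G] [IsTopologicalGroup G] [CompactSpace G]
      [MeasurableSpace G] [BorelSpace G] (r : LatticeRep G) (β : ℝ), ∃ C : ℝ, ∀ (S : ℕ)
      (F : GaugeConfig 4 (2 * S + 1) G → ℝ), Measurable F → (∃ M : ℝ, ∀ U, |F U| ≤ M) →
      ∀ x : Site 4 (2 * S + 1),
      ∫ U, ∫ k, (F U - F (gaugeTransform (Function.update (1 : Site 4 (2 * S + 1) → G) x k) U)) ^ 2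
        ∂(haarProbability G) ∂(wilsonMeasure r.ρ β : Measure (GaugeConfig 4 (2 * S + 1) G)) ≤
      C * ∑ ℓ : Edge 4 (2 * S + 1), if (ℓ.1 = x ∨ ℓ.1.shift ℓ.2 = x) then
          ∫ U, ∫ h, (F U - F (Function.update U ℓ h)) ^ 2
            ∂(haarProbability G) ∂(wilsonMeasure r.ρ β : Measure (GaugeConfig 4 (2 * S + 1) G)) else 0 := by
  intro G _ _ _ _ _ _ r β
  haveI : SecondCountableTopology G :=
    (r.continuous.isClosedEmbedding r.injective).isEmbedding.secondCountableTopology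
  obtain ⟨M, hM0, hM⟩ := exists_bound_trace_re_nonneg r.ρ r.continuous
  -- constants: `κ = |β| · 2 (4+1) #{planes} (N + M)`, `Θ n = 2ⁿ e^{κ n} (2 + 2 e^κ)`, `C = Θ 8`
  set pc : ℝ := (((4 + 1) * Fintype.card {q : Fin 4 × Fin 4 // q.1 < q.2} : ℕ) : ℝ) with hpc
  set κ : ℝ := |β| * (2 * pc * ((r.N : ℝ) + M)) with hκ
  have hκ0 : 0 ≤ κ := by positivity
  set Θ : ℕ → ℝ := fun n => 2 ^ n * Real.exp (κ * n) * (2 + 2 * Real.exp κ) with hΘ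
  refine ⟨Θ (4 + 4), ?_⟩
  intro S F hF hbdd x
  obtain ⟨B, hB⟩ := hbdd
  haveI hprob : IsProbabilityMeasure (wilsonMeasure (d := 4) (L := 2 * S + 1) r.ρ β) :=
    isProbabilityMeasure_wilsonMeasure (d := 4) (L := 2 * S + 1) r.ρ r.continuous β
  set μ : Measure (GaugeConfig 4 (2 * S + 1) G) := wilsonMeasure (d := 4) (L := 2 * S + 1) r.ρ β
  -- the translation-density bound of the Wilson measure, uniformly in the volume
  have hdens : ∀ (A : Finset (Edge 4 (2 * S + 1))) (a c : Edge 4 (2 * S + 1) → G),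
      (∀ e ∉ A, a e = 1) → (∀ e ∉ A, c e = 1) →
      ∀ ψ : GaugeConfig 4 (2 * S + 1) G → ℝ, (∀ V, 0 ≤ ψ V) → Integrable ψ μ →
      ∫ V, ψ (fun e => a e * V e * (c e)⁻¹) ∂μ ≤
        Real.exp (κ * A.card) * ∫ V, ψ V ∂μ :=
    fun A a c ha hc ψ => integral_comp_edgeTranslate_wilsonMeasure_le r.ρ β hM A a c ha hc
  -- the incident links and the link resampling costs
  set I : Finset (Edge 4 (2 * S + 1)) :=
    Finset.univ.filter fun ℓ : Edge 4 (2 * S + 1) => ℓ.1 = x ∨ ℓ.1.shift ℓ.2 = x with hI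
  have hIcard : I.card ≤ 4 + 4 := card_filter_incident_le x
  set H : Edge 4 (2 * S + 1) → ℝ := fun ℓ =>
    ∫ U, ∫ h, (F U - F (Function.update U ℓ h)) ^ 2 ∂(haarProbability G) ∂μ with hH
  have hHsum0 : 0 ≤ ∑ ℓ ∈ I, H ℓ :=
    Finset.sum_nonneg fun ℓ _ => integral_nonneg fun _ => integral_nonneg fun _ => sq_nonneg _
  have hsum : (∑ ℓ : Edge 4 (2 * S + 1), if (ℓ.1 = x ∨ ℓ.1.shift ℓ.2 = x) then H ℓ else 0) =
      ∑ ℓ ∈ I, H ℓ := by rw [hI, Finset.sum_filter]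
  have hΘmono : Θ I.card ≤ Θ (4 + 4) := by
    have h1 : (2 : ℝ) ^ I.card ≤ 2 ^ (4 + 4) := pow_le_pow_right₀ one_le_two hIcard
    have h2 : Real.exp (κ * (I.card : ℝ)) ≤ Real.exp (κ * ((4 + 4 : ℕ) : ℝ)) :=
      Real.exp_le_exp.2 (mul_le_mul_of_nonneg_left (by exact_mod_cast hIcard) hκ0)
    exact mul_le_mul (mul_le_mul h1 h2 (Real.exp_pos _).le (by positivity)) le_rfl
      (by positivity) (by positivity)
  -- for each fixed rotation angle `k`: telescoping over the incident links
  have hk : ∀ k : G, ∫ U, (F U - F (gaugeTransform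
      (Function.update (1 : Site 4 (2 * S + 1) → G) x k) U)) ^ 2 ∂μ ≤
        Θ (4 + 4) * ∑ ℓ ∈ I, H ℓ := by
    intro k
    have hgt : ∀ U : GaugeConfig 4 (2 * S + 1) G,
        gaugeTransform (Function.update (1 : Site 4 (2 * S + 1) → G) x k) U =
          fun e => (if e.1 = x then k else 1) * U e * (if e.1.shift e.2 = x then k else 1)⁻¹ := by
      intro U; funext e; simp only [gaugeTransform, Function.update_apply, Pi.one_apply]
    have ha : ∀ e ∉ I, (if e.1 = x then k else (1 : G)) = 1 := fun e he => by
      simp only [hI, Finset.mem_filter, Finset.mem_univ, true_and, not_or] at he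
      simp [he.1]
    have hc : ∀ e ∉ I, (if e.1.shift e.2 = x then k else (1 : G)) = 1 := fun e he => by
      simp only [hI, Finset.mem_filter, Finset.mem_univ, true_and, not_or] at he
      simp [he.2]
    have h := SiteRotation.integral_sq_sub_translate_le (μ := μ) hκ0 hdens hF hB I
      (fun e => if e.1 = x then k else 1) (fun e => if e.1.shift e.2 = x then k else 1) ha hc
    simp_rw [hgt]
    exact h.trans (mul_le_mul_of_nonneg_right hΘmono hHsum0)
  -- swap the integrals and average the `k`-uniform bound over Haar
  have hcont : Continuous fun p : GaugeConfig 4 (2 * S + 1) G × G =>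
      gaugeTransform (Function.update (1 : Site 4 (2 * S + 1) → G) x p.2) p.1 :=
    (continuous_gaugeAction_univ (d := 4) (L := 2 * S + 1) (G := G)).comp
      ((continuous_const.update x continuous_snd).prodMk continuous_fst)
  have hint : Integrable (Function.uncurry fun (U : GaugeConfig 4 (2 * S + 1) G) (k : G) =>
      (F U - F (gaugeTransform (Function.update (1 : Site 4 (2 * S + 1) → G) x k) U)) ^ 2)
      (μ.prod (haarProbability G)) :=
    SiteRotation.integrable_sq_sub (hF.comp measurable_fst) (hF.comp hcont.measurable)
      (fun p => hB _) fun p => hB _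
  calc ∫ U, ∫ k, (F U - F (gaugeTransform
          (Function.update (1 : Site 4 (2 * S + 1) → G) x k) U)) ^ 2 ∂(haarProbability G) ∂μ
      = ∫ k, ∫ U, (F U - F (gaugeTransform
          (Function.update (1 : Site 4 (2 * S + 1) → G) x k) U)) ^ 2 ∂μ ∂(haarProbability G) :=
        integral_integral_swap hint
    _ ≤ ∫ _k, Θ (4 + 4) * ∑ ℓ ∈ I, H ℓ ∂(haarProbability G) :=
        integral_mono_of_nonneg (ae_of_all _ fun k => integral_nonneg fun U => sq_nonneg _)
          (integrable_const _) (ae_of_all _ hk)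
    _ = Θ (4 + 4) * ∑ ℓ ∈ I, H ℓ := by rw [integral_const, probReal_univ, one_smul]
    _ = Θ (4 + 4) *
          ∑ ℓ : Edge 4 (2 * S + 1), if (ℓ.1 = x ∨ ℓ.1.shift ℓ.2 = x) then H ℓ else 0 := by
        rw [hsum]

end Summit.QuantumFields.YangMills.Theorems.SusceptibilityToPoincare

end
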